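import Literature.Analysis.FluidPDE.PeriodicCylinderNeumannFrameClass
import Literature.Analysis.FunctionSpaces.SteinExtension
import Mathlib.Analysis.SpecialFunctions.SmoothTransition
import HarnessLib

/-!
# Cartesian Sobolev regularity of the weak periodic Neumann solution away from the axis

(module docstring completed below)
-/

noncomputable section

open MeasureTheory Set Function Filter Topology TopologicalSpace WithLp Metric
open scoped ContDiff NNReal ENNReal InnerProductSpace RealInnerProductSpace

namespace Literature.Analysis.FluidPDE

open Literature.Analysis.FunctionSpaces

/-- Local notation for physical space `ℝ³ = EuclideanSpace ℝ (Fin 3)`. -/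
local notation "ℝ³" => EuclideanSpace ℝ (Fin 3)

/-- Local notation for the closed unit cylinder `{r ≤ 1}`. -/
local notation "𝕂" => closure (SetLike.coe unitCylinder : Set (EuclideanSpace ℝ (Fin 3)))

namespace PeriodicCylinder

variable {L : ℝ}

/-! ### A smooth global version of `1/ρ` away from the axis -/

/-- A smooth function on `ℝ` equal to `t⁻¹` for `t ≥ 1/4`: `σ(t) = ψ(t)/t` with `ψ` a smooth
transition vanishing for `t ≤ 1/8` and equal to `1` for `t ≥ 1/4`. [folklore] -/
theorem exists_smooth_inv : ∃ σ : ℝ → ℝ, ContDiff ℝ ∞ σ ∧ ∀ t : ℝ, 1 / 4 ≤ t → σ t = t⁻¹ := by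
  set ψ : ℝ → ℝ := fun t => Real.smoothTransition (8 * t - 1) with hψ
  have hψs : ContDiff ℝ ∞ ψ :=
    Real.smoothTransition.contDiff.comp ((contDiff_const.mul contDiff_id).sub contDiff_const)
  have hψ0 : ∀ t, t ≤ 1 / 8 → ψ t = 0 := fun t ht =>
    Real.smoothTransition.zero_of_nonpos (by linarith)
  have hψ1 : ∀ t, 1 / 4 ≤ t → ψ t = 1 := fun t ht =>
    Real.smoothTransition.one_of_one_le (by linarith)
  refine ⟨fun t => ψ t * t⁻¹, ?_, fun t ht => by simp [hψ1 t ht]⟩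
  refine contDiff_iff_contDiffAt.2 fun t => ?_
  by_cases ht : t < 1 / 8
  · -- locally zero
    have hev : (fun t => ψ t * t⁻¹) =ᶠ[𝓝 t] fun _ => 0 := by
      filter_upwards [Iio_mem_nhds ht] with s hs
      simp [hψ0 s hs.le]
    exact (contDiffAt_const (c := (0 : ℝ))).congr_of_eventuallyEq hev
  · have ht0 : t ≠ 0 := by intro h0; exact ht (by rw [h0]; norm_num)
    exact hψs.contDiffAt.mul (contDiffAt_inv ℝ ht0)

/-! ### Fields agreeing on the domain -/

/-- Weak derivatives along two smooth fields which agree on `Ω` coincide. [folklore] -/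
theorem _root_.Literature.Analysis.FluidPDE.HasWeakDerivAlong.congr_field {Ω : Opens ℝ³} {X X' : ℝ³ → ℝ³}
    {g g' : ℝ³ → ℝ} (h : HasWeakDerivAlong Ω volume X g g')
    (heq : ∀ x ∈ (Ω : Set ℝ³), X x = X' x) : HasWeakDerivAlong Ω volume X' g g' := by
  refine ⟨h.locallyIntegrableOn, h.locallyIntegrableOn_deriv, fun φ hφ => ?_⟩
  rw [← h.integral_eq φ hφ]
  refine setIntegral_congr_fun Ω.isOpen.measurableSet fun x hx => ?_
  have hfd : fderiv ℝ X' x = fderiv ℝ X x := by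
    refine Filter.EventuallyEq.fderiv_eq ?_
    filter_upwards [Ω.isOpen.mem_nhds hx] with y hy
    exact (heq y hy).symm
  simp only [heq x hx, VectorCalculus.divergence, hfd]

/-! ### Cartesian weak derivatives away from the axis -/

section Cartesian

variable (Ω' : Opens ℝ³)

/-- The hypothesis on the sub-domain: it lies in the cell and stays away from the axis,
`ρ = ‖x_h‖² > 1/4`. [folklore] -/
structure IsWallPiece (L : ℝ) (Ω' : Opens ℝ³) : Prop where
  le_cell : Ω' ≤ cylinderCell L
  rsq_gt : ∀ x ∈ (Ω' : Set ℝ³), (1 : ℝ) / 4 < ‖horizontalProj x‖ ^ 2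

variable {Ω'}

/-- **Cartesian weak derivatives of frame-class functions away from the axis**: on a sub-domain of
the cell where `ρ > 1/4`, every function of the frame class has, along each coordinate direction
`eᵢ`, a weak derivative in the frame class — `e₀ = (x₀ x_h − x₁ Jx)/ρ`, `e₁ = (x₁ x_h + x₀ Jx)/ρ`,
`e₂ = e_z`, with `1/ρ` replaced by a global smooth function equal to it where `ρ ≥ 1/4`. [folklore] -/
theorem IsFrameClass.exists_hasWeakDerivAlong_single (hL : 0 < L) (hΩ : IsWallPiece L Ω')
    {f : ℝ³ → ℝ} (hf : IsFrameClass L f) (i : Fin 3) :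
    ∃ f' : ℝ³ → ℝ, IsFrameClass L f' ∧
      HasWeakDerivAlong Ω' volume (fun _ => EuclideanSpace.single i (1 : ℝ)) f f' := by
  obtain ⟨σ, hσ, hσeq⟩ := exists_smooth_inv
  have hPc : ContDiff ℝ ∞ fun y : ℝ³ => horizontalProj y := horizontalProjL.contDiff
  have hP1 : ContDiff ℝ 1 fun y : ℝ³ => horizontalProj y := hPc.of_le (by exact_mod_cast le_top)
  have hJ1 : ContDiff ℝ 1 rotGen := contDiff_rotGen
  obtain ⟨fP, hfPc, hfP⟩ := hf.exists_hasWeakDerivAlong hL (Or.inl rfl)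
  obtain ⟨fJ, hfJc, hfJ⟩ := hf.exists_hasWeakDerivAlong hL (Or.inr (Or.inl rfl))
  obtain ⟨fE, hfEc, hfE⟩ := hf.exists_hasWeakDerivAlong hL (Or.inr (Or.inr rfl))
  -- the smooth coefficients `x₀ σ(ρ)`, `x₁ σ(ρ)`
  have hρs : ContDiff ℝ ∞ fun x : ℝ³ => σ (‖horizontalProj x‖ ^ 2) := hσ.comp contDiff_rsq
  have hc0 : ContDiff ℝ ∞ fun x : ℝ³ => x 0 * σ (‖horizontalProj x‖ ^ 2) := (contDiff_cylCoordFun 0).mul hρs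
  have hc1 : ContDiff ℝ ∞ fun x : ℝ³ => x 1 * σ (‖horizontalProj x‖ ^ 2) := (contDiff_cylCoordFun 1).mul hρs
  have hσρ : ∀ x ∈ (Ω' : Set ℝ³), σ (‖horizontalProj x‖ ^ 2) * ‖horizontalProj x‖ ^ 2 = 1 := fun x hx => by
    rw [hσeq _ (hΩ.rsq_gt x hx).le, inv_mul_cancel₀ (by linarith [hΩ.rsq_gt x hx])]
  have hc1n : ContDiff ℝ ∞ fun x : ℝ³ => -(x 1 * σ (‖horizontalProj x‖ ^ 2)) := hc1.neg
  have hc01 : ContDiff ℝ 1 fun x : ℝ³ => x 0 * σ (‖horizontalProj x‖ ^ 2) := hc0.of_le (by exact_mod_cast le_top)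
  have hc11 : ContDiff ℝ 1 fun x : ℝ³ => x 1 * σ (‖horizontalProj x‖ ^ 2) := hc1.of_le (by exact_mod_cast le_top)
  have hc1n1 : ContDiff ℝ 1 fun x : ℝ³ => -(x 1 * σ (‖horizontalProj x‖ ^ 2)) := hc1n.of_le (by exact_mod_cast le_top)
  fin_cases i
  · -- `e₀ = c₀ x_h − c₁ Jx`
    have h1 := (hfP.smul_field hP1 hc0).add_field (hc01.smul hP1) (hc1n1.smul hJ1) (hfJ.smul_field hJ1 hc1n)
    refine ⟨_, (hfPc.smul hc0).add (hfJc.smul hc1n), ?_⟩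
    refine (h1.mono hΩ.le_cell).congr_field fun x hx => ?_
    have key := hσρ x hx
    nth_rewrite 2 [rsq_eq] at key
    show (x 0 * σ (‖horizontalProj x‖ ^ 2)) • horizontalProj x + (-(x 1 * σ (‖horizontalProj x‖ ^ 2))) • rotGen x =
      EuclideanSpace.single 0 1
    set s := σ (‖horizontalProj x‖ ^ 2) with hs
    ext j
    fin_cases j <;> simp [horizontalProj_apply_eq, rotGen] <;> nlinarith [key]
  · -- `e₁ = c₁ x_h + c₀ Jx`
    have h1 := (hfP.smul_field hP1 hc1).add_field (hc11.smul hP1) (hc01.smul hJ1) (hfJ.smul_field hJ1 hc0)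
    refine ⟨_, (hfPc.smul hc1).add (hfJc.smul hc0), ?_⟩
    refine (h1.mono hΩ.le_cell).congr_field fun x hx => ?_
    have key := hσρ x hx
    nth_rewrite 2 [rsq_eq] at key
    show (x 1 * σ (‖horizontalProj x‖ ^ 2)) • horizontalProj x + (x 0 * σ (‖horizontalProj x‖ ^ 2)) • rotGen x =
      EuclideanSpace.single 1 1
    set s := σ (‖horizontalProj x‖ ^ 2) with hs
    ext j
    fin_cases j <;> simp [horizontalProj_apply_eq, rotGen] <;> nlinarith [key]
  · -- `e₂ = e_z`
    refine ⟨fE, hfEc, ?_⟩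
    have h1 := hfE.mono hΩ.le_cell
    refine h1.congr_field fun x _ => ?_
    simp [eZ_eq_single]

/-- **Frame-class functions have Sobolev regularity of every order away from the axis**: on a
sub-domain of the cell where `ρ > 1/4`, every function of the frame class lies in `W^{k,2}` for
every `k`. [folklore] -/
theorem IsFrameClass.memSobolevDomain (hL : 0 < L) (hΩ : IsWallPiece L Ω') (k : ℕ) :
    ∀ {f : ℝ³ → ℝ}, IsFrameClass L f → MemSobolevDomain k 2 Ω' volume f := by
  induction k with
  | zero =>
    intro f hf
    rw [memSobolevDomain_zero_iff]
    exact hf.memLp.mono_measure (Measure.restrict_mono hΩ.le_cell le_rfl)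
  | succ k ih =>
    intro f hf
    refine ⟨hf.memLp.mono_measure (Measure.restrict_mono hΩ.le_cell le_rfl), ?_⟩
    choose f' hf'c hf' using fun i => hf.exists_hasWeakDerivAlong_single hL hΩ i
    set b := EuclideanSpace.basisFun (Fin 3) ℝ with hb
    have hb' : ∀ i, HasWeakDerivAlong Ω' volume (fun _ => b i) f (f' i) := fun i => by
      have := hf' i
      simpa [hb] using this
    refine ⟨_, HasWeakDerivAlong.hasWeakFDerivOn_of_basis b hb' 0, fun v => ?_⟩
    have heq : (fun x => (∑ i, (innerSL ℝ (b i)).smulRight (f' i x)) v) =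
        fun x => ∑ i, ⟪(b i : ℝ³), v⟫ * f' i x := by
      funext x
      simp [ContinuousLinearMap.smulRight_apply, smul_eq_mul]
    rw [heq]
    have hclass : IsFrameClass L fun x => ∑ i, ⟪(b i : ℝ³), v⟫ * f' i x := by
      have : ∀ s : Finset (Fin 3), IsFrameClass L fun x => ∑ i ∈ s, ⟪(b i : ℝ³), v⟫ * f' i x := by
        intro s
        induction s using Finset.induction_on with
        | empty => simpa using IsFrameClass.zero (L := L)
        | insert a s ha ih' =>
          have h2 := ((hf'c a).smul (contDiff_const (c := ⟪(b a : ℝ³), v⟫))).add ih'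
          refine h2.congr (funext fun x => ?_)
          rw [Finset.sum_insert ha]
      exact this Finset.univ
    exact ih hclass

/-- **The potential has Sobolev regularity of every order away from the axis**: on a sub-domain of
the cell where `ρ > 1/4`, the potential `q` of the weak Neumann solution `∇q[h₀,h₁]` with smooth
periodic data (`∫_cell h₀ = 0`) lies in `W^{k,2}` for every `k`. [folklore] -/
theorem memSobolevDomain_potential_neumannGrad (hL : 0 < L) (hΩ : IsWallPiece L Ω') {h₀ : ℝ³ → ℝ}
    {h₁ : ℝ³ → ℝ³} (hh₀ : IsSmoothPeriodic L h₀) (hh₁ : IsSmoothPeriodic L h₁)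
    (hmean : ∫ x in (cylinderCell L : Set ℝ³), h₀ x = 0) (k : ℕ) :
    MemSobolevDomain k 2 Ω' volume
      ((potential (neumannGrad L (toCell L h₀) (toCell L h₁)) : Lp ℝ 2 (cellMeasure L)) : ℝ³ → ℝ) := by
  set Gg := neumannGrad L (toCell L h₀) (toCell L h₁) with hGg
  have hq := hasWeakFDerivOn_potential hL Gg
  have hmem : MemLp ((potential Gg : Lp ℝ 2 (cellMeasure L)) : ℝ³ → ℝ) 2 (volume.restrict Ω') :=
    (Lp.memLp _).mono_measure (Measure.restrict_mono hΩ.le_cell le_rfl)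
  cases k with
  | zero => exact hmem
  | succ k =>
    refine ⟨hmem, _, HasWeakFDerivOn.mono_set_holds hq hΩ.le_cell, fun v => ?_⟩
    -- the component `⟪G x, v⟫ = Σᵢ vᵢ ⟪eᵢ, G x⟫` is in the frame class
    simp only [innerSL_apply_apply]
    have hP := IsFrameClass.pairP hh₀ hh₁ hmean
    have hJ := IsFrameClass.pairJ hh₀ hh₁ hmean
    have hE := IsFrameClass.pairE hh₀ hh₁ hmean
    rw [← hGg] at hP hJ hE
    obtain ⟨σ, hσ, hσeq⟩ := exists_smooth_inv
    have hρs : ContDiff ℝ ∞ fun x : ℝ³ => σ (‖horizontalProj x‖ ^ 2) := hσ.comp contDiff_rsq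
    have hc0 : ContDiff ℝ ∞ fun x : ℝ³ => x 0 * σ (‖horizontalProj x‖ ^ 2) := (contDiff_cylCoordFun 0).mul hρs
    have hc1 : ContDiff ℝ ∞ fun x : ℝ³ => x 1 * σ (‖horizontalProj x‖ ^ 2) := (contDiff_cylCoordFun 1).mul hρs
    -- the frame-class function equal to `⟪G, v⟫` on `Ω'`
    have hcl : IsFrameClass L fun x =>
        (v 0 * (x 0 * σ (‖horizontalProj x‖ ^ 2)) + v 1 * (x 1 * σ (‖horizontalProj x‖ ^ 2))) *
          ⟪horizontalProj x, ((Gg : gradSpace L) : Lp ℝ³ 2 (cellMeasure L)) x⟫ +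
        (v 1 * (x 0 * σ (‖horizontalProj x‖ ^ 2)) - v 0 * (x 1 * σ (‖horizontalProj x‖ ^ 2))) *
          ⟪rotGen x, ((Gg : gradSpace L) : Lp ℝ³ 2 (cellMeasure L)) x⟫ +
        v 2 * ⟪(eZ : ℝ³), ((Gg : gradSpace L) : Lp ℝ³ 2 (cellMeasure L)) x⟫ :=
      ((hP.smul ((contDiff_const.mul hc0).add (contDiff_const.mul hc1))).add
        (hJ.smul ((contDiff_const.mul hc0).sub (contDiff_const.mul hc1)))).add (hE.smul contDiff_const)
    refine (IsFrameClass.memSobolevDomain hL hΩ k hcl).congr_ae ?_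
    filter_upwards [ae_restrict_mem Ω'.isOpen.measurableSet] with x hx
    -- pointwise linear algebra on `Ω'`, where `σ(ρ) ρ = 1`
    have key : σ (‖horizontalProj x‖ ^ 2) * (x 0 ^ 2 + x 1 ^ 2) = 1 := by
      rw [← rsq_eq, hσeq _ (hΩ.rsq_gt x hx).le, inv_mul_cancel₀ (by linarith [hΩ.rsq_gt x hx])]
    set w : ℝ³ := (((Gg : gradSpace L) : Lp ℝ³ 2 (cellMeasure L)) : ℝ³ → ℝ³) x with hw
    set s := σ (‖horizontalProj x‖ ^ 2) with hs
    have hh : ⟪horizontalProj x, w⟫ = x 0 * w 0 + x 1 * w 1 := by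
      rw [horizontalProj_apply_eq]; simp [Fin.sum_univ_three, inner]; ring
    have hj : ⟪rotGen x, w⟫ = x 0 * w 1 - x 1 * w 0 := inner_rotGen_left x w
    have he : ⟪(eZ : ℝ³), w⟫ = w 2 := by simp [eZ_eq_single, inner]
    have hv : ⟪w, v⟫ = w 0 * v 0 + w 1 * v 1 + w 2 * v 2 := by
      simp [Fin.sum_univ_three, inner]; ring
    rw [hh, hj, he, hv]
    linear_combination (v 0 * w 0 + v 1 * w 1) * key

end Cartesian

end PeriodicCylinder

end Literature.Analysis.FluidPDE
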